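import Mathlib.RingTheory.IsTensorProduct
import Literature.AlgebraicGeometry.HodgeTheory.LocallyTrivialExtensionClasses
import Summits.HodgeConjecture.HodgeConjecture.Theorems.LinearSystemTorelliLocalTubeSpanAlgebra
import Summits.HodgeConjecture.HodgeConjecture.Theorems.LinearSystemTorelliLocalTubeSpanRetract
import Summits.HodgeConjecture.HodgeConjecture.Theorems.LinearSystemTorelliLocalTubeSpanCoordinatesUp
import Summits.HodgeConjecture.HodgeConjecture.Theorems.LinearSystemTorelliLocalTubeSpanFiniteWitness
import Summits.HodgeConjecture.HodgeConjecture.Theorems.LinearSystemTorelliLocalTubeSpanBaseChangeRetraction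
import Summits.HodgeConjecture.HodgeConjecture.Theorems.LinearSystemTorelliLocalTubeSpanBaseChangeCoordinates

/-!
# Route LinearSystemTorelli — crux `LocalTubeSpan` (stmt-HodgeConjecture-2490): base change of cyclic detection

Composition file (`--supports stmt-HodgeConjecture-2490`, line `Sketch` of the crux chain, cycle 4
"portability of cyclic detection").  The line's injectivity theorems for Schnell's third map
`evalCoinv A : H¹(G, A) → ∏_g A/(g - 1)A` ("cyclic detection": a `1`-cocycle undetected by every
element is a coboundary) are over `ℚ` — they must be: the thin boundary
(`…LocalTubeSpanThin`) shows detection lives on the arithmetic of the vanishing lattice — while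
the tree's hyperplane-section local systems (`HyperplaneSectionLocalSystem`,
`vanishingLocalSystem`, `monodromyRepObj`) are over `ℂ` with a fibrewise `ℚ`-structure
(`IsRationalClass`; `ofRatClassBaseChangeEquiv : ℂ ⊗_ℚ Hᵏ(X; ℚ) ≃ₗ[ℂ] Hᵏ(X; ℂ)`).  This file
closes that gap ("the BASE-CHANGE GAP" of the crux NOTES):

* `localTubeSpan_injective_evalCoinv_iff_of_isBaseChange` — for a field `k`, a non-trivial
  commutative `k`-algebra `K`, a FINITE-DIMENSIONAL `k`-representation `A` of ANY group `G` and a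
  `K`-representation `A'` that is a base change of `A` along an equivariant `k`-linear `i`
  (Mathlib's `IsBaseChange K i`), Schnell's third map is injective for `A` iff it is for `A'`;
* `localTubeSpan_injective_evalCoinv_iff_of_tensorEquiv` — the same from a `K`-linear
  `e : K ⊗_k A ≃ A'` intertwining `c ⊗ ρ(g)x ↦ ρ'(g) e(c ⊗ x)` (the shape of the tree's
  complexification), with no `k`-module structure on `A'` required;
* `localTubeSpan_ker_evalCoinvOn_eq_H1resKer_of_tensorEquiv` — the line's surrogate of the crux
  over `K` at a local group `S ≤ G` (`ker (evalCoinvOn A' S) = H1resKer A' S`) from injectivity of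
  the third map of the `k`-form restricted to `S`.

So every theorem of the `ℚ`-spine (NC-nodal, complete orbit with radical, mixed, multi-cluster,
connected clusters) holds verbatim for the complexified monodromy representation of a typed crux,
and conversely nothing is lost by complexifying.  NOTE the hypothesis is finite-dimensionality of
the `k`-form, not finite generation of `G`: the ascent decomposes an undetected `K`-cocycle along a
`k`-basis of `K` into undetected `k`-cocycles `φ_j = d x_j` and needs only finitely many `φ_j ≠ 0`,
which holds because each non-zero `φ_j` moves `x_j` off the invariants `A^G`, and `A^G` is cut out
by finitely many group elements (`…FiniteWitness`).  Ingredients: `…Retract` (descent along an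
equivariant retraction), `…CoordinatesUp` (ascent along equivariant coordinates),
`…FiniteWitness`, `…BaseChangeRetraction` / `…BaseChangeCoordinates` (the data from
`IsBaseChange`).  Pure algebra over Mathlib; no named facts, no geometry.
-/

-- `Summit.HodgeConjecture.HodgeConjecture.Theorems` is the mandated namespace (single-conjunct summit:
-- Sub = Summit), which `linter.dupNamespace` flags on every declaration; the lakefile turns the
-- linter off tree-wide (weak option), restated here so stand-alone elaboration is warning-free too.
set_option linter.dupNamespace false

noncomputable section

open scoped TensorProduct
open CategoryTheory groupCohomology
open Literature.AlgebraicGeometry.HodgeTheory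

namespace Summit.HodgeConjecture.HodgeConjecture.Theorems

universe u

variable {k K G : Type u} [Group G]

/-- **Base change of cyclic detection** (`IsBaseChange` form).  For a field `k`, a non-trivial
commutative `k`-algebra `K`, a finite-dimensional `k`-representation `A` of any group `G` and a
`K`-representation `A'` that is a base change of `A` along a `G`-equivariant `k`-linear `i`
(`IsBaseChange K i`: `K ⊗_k A ≃ A'`, `c ⊗ x ↦ c • i x`), Schnell's third map
`H¹(G, A) → ∏_g A/(g - 1)A` is injective iff `H¹(G, A') → ∏_g A'/(g - 1)A'` is.
(`⇒`: decompose along the natural coordinates of the base change and ascend;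
`⇐`: descend along the natural retraction.) [folklore] -/
theorem localTubeSpan_injective_evalCoinv_iff_of_isBaseChange [Field k] [CommRing K] [Nontrivial K]
    [Algebra k K] (A : Rep k G) [FiniteDimensional k A.V] (A' : Rep K G) [Module k A'.V]
    [IsScalarTower k K A'.V] (i : A.V →ₗ[k] A'.V) (hi : IsBaseChange K i)
    (hiG : ∀ (g : G) (x : A.V), i (A.ρ g x) = A'.ρ g (i x)) :
    Function.Injective (evalCoinv A) ↔ Function.Injective (evalCoinv A') := by
  -- the additive shadows of the `k`-linear data (the transport theorems are stated for additive maps)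
  have hiG' : ∀ (g : G) (x : A.V), i.toAddMonoidHom (A.ρ g x) = A'.ρ g (i.toAddMonoidHom x) :=
    fun g x => by simpa only [LinearMap.toAddMonoidHom_coe] using hiG g x
  constructor
  · intro hinj
    obtain ⟨J, b, π, hfin, hrec, hnat⟩ := localTubeSpan_exists_coordinates_of_isBaseChange (K := K) i hi
    obtain ⟨F, hF⟩ := localTubeSpan_exists_finset_fixed_imp_fixed A
    have hπ' : ∀ (j : J) (g : G) (x' : A'.V),
        (π j).toAddMonoidHom (A'.ρ g x') = A.ρ g ((π j).toAddMonoidHom x') :=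
      fun j g x' => by
        simpa only [LinearMap.toAddMonoidHom_coe] using hnat (A.ρ g) (A'.ρ g) (hiG g) j x'
    have hfin' : ∀ x' : A'.V, (Function.support fun j => (π j).toAddMonoidHom x').Finite :=
      fun x' => by simpa only [LinearMap.toAddMonoidHom_coe] using hfin x'
    have hrec' : ∀ (x' : A'.V) (T : Finset J), (∀ j ∉ T, (π j).toAddMonoidHom x' = 0) →
        x' = ∑ j ∈ T, b j • i.toAddMonoidHom ((π j).toAddMonoidHom x') :=
      fun x' T hT => by
        simp only [LinearMap.toAddMonoidHom_coe] at hT ⊢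
        exact hrec x' T hT
    exact localTubeSpan_injective_evalCoinv_of_coordinates A A' i.toAddMonoidHom hiG' b
      (fun j => (π j).toAddMonoidHom) hπ' hfin' hrec' F hF hinj
  · intro hinj
    obtain ⟨P, hPi, hnat⟩ := localTubeSpan_exists_retraction_of_isBaseChange (K := K) i hi
    have hP' : ∀ (g : G) (x' : A'.V),
        P.toAddMonoidHom (A'.ρ g x') = A.ρ g (P.toAddMonoidHom x') :=
      fun g x' => by
        simpa only [LinearMap.toAddMonoidHom_coe] using hnat (A.ρ g) (A'.ρ g) (hiG g) x'
    have hPi' : ∀ x : A.V, P.toAddMonoidHom (i.toAddMonoidHom x) = x := fun x => by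
      simpa only [LinearMap.toAddMonoidHom_coe] using hPi x
    exact localTubeSpan_injective_evalCoinv_of_retract A A' i.toAddMonoidHom hiG' P.toAddMonoidHom
      hP' hPi' hinj

/-- **Base change of cyclic detection** (tensor form — the shape of the tree's complexification
`ofRatClassBaseChangeEquiv : ℂ ⊗_ℚ Hᵏ(X; ℚ) ≃ₗ[ℂ] Hᵏ(X; ℂ)`).  If a `K`-linear
`e : K ⊗_k A ≃ A'` intertwines `id ⊗ ρ(g)` with `ρ'(g)`, then Schnell's third map is injective for
the finite-dimensional `k`-representation `A` of ANY group `G` iff it is for the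
`K`-representation `A'`.  Hence every injectivity theorem of the `ℚ`-spine of the crux holds
verbatim for the complexified monodromy representation, and nothing is lost by complexifying.
[folklore] -/
theorem localTubeSpan_injective_evalCoinv_iff_of_tensorEquiv [Field k] [CommRing K] [Nontrivial K]
    [Algebra k K] (A : Rep k G) [FiniteDimensional k A.V] (A' : Rep K G)
    (e : K ⊗[k] A.V ≃ₗ[K] A'.V)
    (he : ∀ (g : G) (c : K) (x : A.V), e (c ⊗ₜ A.ρ g x) = A'.ρ g (e (c ⊗ₜ x))) :
    Function.Injective (evalCoinv A) ↔ Function.Injective (evalCoinv A') := by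
  letI : Module k A'.V := Module.compHom A'.V (algebraMap k K)
  haveI : IsScalarTower k K A'.V :=
    ⟨fun c d x => show ((c • d) • x : A'.V) = algebraMap k K c • (d • x) by
      rw [Algebra.smul_def, mul_smul]⟩
  let i : A.V →ₗ[k] A'.V :=
    (e.restrictScalars k).toLinearMap ∘ₗ TensorProduct.mk k K A.V 1
  have hi_apply : ∀ x, i x = e (1 ⊗ₜ x) := fun x => rfl
  have hi : IsBaseChange K i := IsBaseChange.of_equiv e fun x => (hi_apply x).symm
  have hiG : ∀ (g : G) (x : A.V), i (A.ρ g x) = A'.ρ g (i x) := fun g x => by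
    rw [hi_apply, hi_apply, ← he g 1 x]
  exact localTubeSpan_injective_evalCoinv_iff_of_isBaseChange A A' i hi hiG

/-- **The surrogate crux over `K` from the `k`-form.**  Under the hypotheses of
`localTubeSpan_injective_evalCoinv_iff_of_tensorEquiv`, at a subgroup `S ≤ G` (a local
fundamental group): if Schnell's third map of the `k`-form `A|_S` is injective, then the classes
of `H¹(G, A')` undetected by every element of `S` are exactly those restricting to zero on `S` —
the line's surrogate `ker (evalCoinvOn A' S) = H1resKer A' S` of the crux LocalTubeSpan, for the
complexified representation. [folklore] -/
theorem localTubeSpan_ker_evalCoinvOn_eq_H1resKer_of_tensorEquiv [Field k] [CommRing K]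
    [Nontrivial K] [Algebra k K] (A : Rep k G) [FiniteDimensional k A.V] (A' : Rep K G)
    (e : K ⊗[k] A.V ≃ₗ[K] A'.V)
    (he : ∀ (g : G) (c : K) (x : A.V), e (c ⊗ₜ A.ρ g x) = A'.ρ g (e (c ⊗ₜ x)))
    (S : Subgroup G) (hinj : Function.Injective (evalCoinv (Rep.res S.subtype A))) :
    LinearMap.ker (evalCoinvOn A' S) = H1resKer A' S :=
  localTubeSpan_ker_evalCoinvOn_eq_H1resKer_of_injective A' S
    ((localTubeSpan_injective_evalCoinv_iff_of_tensorEquiv (Rep.res S.subtype A)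
      (Rep.res S.subtype A') e (fun g c x => he g c x)).1 hinj)

end Summit.HodgeConjecture.HodgeConjecture.Theorems

end
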